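import Mathlib
import Literature.MathematicalPhysics.StatisticalMechanics.LennardJonesClusters

/-!
# Five-fold sparsity, counting half (crux `SquareWellLayerCake.GapTwelveToBarlow`, card A)

Support for the stub `stub_fiveFoldSparsity` of line `Sketch` of crux stmt-AtomisticToContinuum-15807
(idea card `cone-deficit-fivefold-sparsity`).  This file is the ENERGY-FREE COUNTING that turns two
geometric inputs about all-Good balls of one finite configuration —
(i) NO HOLES (an all-Good ball holds `≥ c·D³` sites) and (ii) a SUB-CUBIC FIVE-FOLD COUNT
(an all-Good ball holds `≤ ε·D³` five-fold sites) — into a bound on the number of sites within `R` of a five-fold bond.  THIS file: the packing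
ingredients — Good sites are `55/57`-separated, so they pack (`card_good_near_le`, from
`card_le_of_separated_of_dist_le`); bad sites spoil few balls (`card_shallow_le`); separated nets
(`exists_separated_net`).  The count itself (`card_fiveFoldNear_le`) and the limit statement are in
`…FiveFoldReduction.lean`.  No new definitions and no notation: the crux's clauses are written out verbatim at every use
(the bad set = sites violating `Good`; the five-fold set = sites with a five-fold bond).
-/

noncomputable section

open scoped BigOperators
open Filter Finset

namespace Summit.AtomisticToContinuum.Crystallization.Theorems.SquareWellLayerCakeGapTwelveToBarlow

open Literature.MathematicalPhysics.StatisticalMechanics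

/-- A site that is not bad is `55/57`-separated from every other site. -/
theorem sep_of_not_mem_bad {N : ℕ} {x : Fin N → EuclideanSpace ℝ (Fin 3)} {i : Fin N} (h : i ∉ (Finset.univ.filter fun i' : Fin _ => ¬ (
      (∀ j', dist (x i') (x j') ≤ 11 / 10 → ∀ k', k' ≠ j' →
          (55 : ℝ) / 57 ≤ dist (x j') (x k')) ∧
      (Finset.univ.filter fun j' => j' ≠ i' ∧ dist (x i') (x j') ≤ 1).card = 12 ∧
      (Finset.univ.filter fun j' => j' ≠ i' ∧ dist (x i') (x j') ≤ 11 / 10).card ≤ 12))) :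
    ∀ k : Fin N, k ≠ i → (55 : ℝ) / 57 ≤ dist (x i) (x k) := by
  classical
  simp only [Finset.mem_filter, Finset.mem_univ, true_and, not_not] at h
  exact h.1 i (by rw [dist_self]; norm_num)

/-- **Packing of Good sites.** The non-bad sites within distance `r` of a point `p` number at
most `(2r/(55/57) + 1)³`: they are pairwise `55/57` apart, so the volume packing bound
`card_le_of_separated_of_dist_le` applies to their (injective) image. -/
theorem card_good_near_le {N : ℕ} (x : Fin N → EuclideanSpace ℝ (Fin 3)) (p : EuclideanSpace ℝ (Fin 3)) {r : ℝ} (hr : 0 ≤ r) :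
    ((Finset.univ.filter fun i : Fin N => i ∉ (Finset.univ.filter fun i' : Fin _ => ¬ (
          (∀ j', dist (x i') (x j') ≤ 11 / 10 → ∀ k', k' ≠ j' →
              (55 : ℝ) / 57 ≤ dist (x j') (x k')) ∧
          (Finset.univ.filter fun j' => j' ≠ i' ∧ dist (x i') (x j') ≤ 1).card = 12 ∧
          (Finset.univ.filter fun j' => j' ≠ i' ∧ dist (x i') (x j') ≤ 11 / 10).card ≤ 12)) ∧ dist (x i) p ≤ r).card : ℝ) ≤
      (2 * r / (55 / 57) + 1) ^ 3 := by
  classical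
  set S := Finset.univ.filter fun i : Fin N => i ∉ (Finset.univ.filter fun i' : Fin _ => ¬ (
        (∀ j', dist (x i') (x j') ≤ 11 / 10 → ∀ k', k' ≠ j' →
            (55 : ℝ) / 57 ≤ dist (x j') (x k')) ∧
        (Finset.univ.filter fun j' => j' ≠ i' ∧ dist (x i') (x j') ≤ 1).card = 12 ∧
        (Finset.univ.filter fun j' => j' ≠ i' ∧ dist (x i') (x j') ≤ 11 / 10).card ≤ 12)) ∧ dist (x i) p ≤ r with hS
  have hinj : Set.InjOn x (S : Set (Fin N)) := by
    intro i hi i' hi' hx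
    by_contra hne
    have hsep := sep_of_not_mem_bad (Finset.mem_filter.1 hi).2.1 i' (Ne.symm hne)
    rw [hx, dist_self] at hsep
    norm_num at hsep
  have hcard : (S.image x).card = S.card := Finset.card_image_of_injOn hinj
  have key := card_le_of_separated_of_dist_le (E := EuclideanSpace ℝ (Fin 3)) (S.image x) p (r := 55 / 57) (R := r)
    (by norm_num) hr
    (by
      intro c hc
      obtain ⟨i, hi, rfl⟩ := Finset.mem_image.1 hc
      exact (Finset.mem_filter.1 hi).2.2)
    (by
      intro c hc d hd hcd
      obtain ⟨i, hi, rfl⟩ := Finset.mem_image.1 hc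
      obtain ⟨i', hi', rfl⟩ := Finset.mem_image.1 hd
      have hne : i' ≠ i := fun h => hcd (by rw [h])
      exact sep_of_not_mem_bad (Finset.mem_filter.1 hi).2.1 i' hne)
  rw [hcard, finrank_euclideanSpace_fin] at key
  simpa using key

/-- **Bad sites spoil few balls.** The sites whose `D`-ball contains a bad site number at most
`#bad · (1 + (2D/(55/57) + 1)³)`: such a site is bad itself, or a non-bad site within `D` of a
bad site, and non-bad sites pack. -/
theorem card_shallow_le {N : ℕ} (x : Fin N → EuclideanSpace ℝ (Fin 3)) {D : ℝ} (hD : 0 ≤ D) :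
    ((Finset.univ.filter fun i : Fin N => ∃ j : Fin N, dist (x i) (x j) ≤ D ∧ j ∈ (Finset.univ.filter fun i' : Fin _ => ¬ (
          (∀ j', dist (x i') (x j') ≤ 11 / 10 → ∀ k', k' ≠ j' →
              (55 : ℝ) / 57 ≤ dist (x j') (x k')) ∧
          (Finset.univ.filter fun j' => j' ≠ i' ∧ dist (x i') (x j') ≤ 1).card = 12 ∧
          (Finset.univ.filter fun j' => j' ≠ i' ∧ dist (x i') (x j') ≤ 11 / 10).card ≤ 12))).card : ℝ) ≤
      ((Finset.univ.filter fun i' : Fin _ => ¬ (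
            (∀ j', dist (x i') (x j') ≤ 11 / 10 → ∀ k', k' ≠ j' →
                (55 : ℝ) / 57 ≤ dist (x j') (x k')) ∧
            (Finset.univ.filter fun j' => j' ≠ i' ∧ dist (x i') (x j') ≤ 1).card = 12 ∧
            (Finset.univ.filter fun j' => j' ≠ i' ∧ dist (x i') (x j') ≤ 11 / 10).card ≤ 12))).card * (1 + (2 * D / (55 / 57) + 1) ^ 3) := by
  classical
  have hsub : (Finset.univ.filter fun i : Fin N => ∃ j : Fin N, dist (x i) (x j) ≤ D ∧ j ∈ (Finset.univ.filter fun i' : Fin _ => ¬ (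
        (∀ j', dist (x i') (x j') ≤ 11 / 10 → ∀ k', k' ≠ j' →
            (55 : ℝ) / 57 ≤ dist (x j') (x k')) ∧
        (Finset.univ.filter fun j' => j' ≠ i' ∧ dist (x i') (x j') ≤ 1).card = 12 ∧
        (Finset.univ.filter fun j' => j' ≠ i' ∧ dist (x i') (x j') ≤ 11 / 10).card ≤ 12))) ⊆
      (Finset.univ.filter fun i' : Fin _ => ¬ (
            (∀ j', dist (x i') (x j') ≤ 11 / 10 → ∀ k', k' ≠ j' →
                (55 : ℝ) / 57 ≤ dist (x j') (x k')) ∧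
            (Finset.univ.filter fun j' => j' ≠ i' ∧ dist (x i') (x j') ≤ 1).card = 12 ∧
            (Finset.univ.filter fun j' => j' ≠ i' ∧ dist (x i') (x j') ≤ 11 / 10).card ≤ 12)) ∪ ((Finset.univ.filter fun i' : Fin _ => ¬ (
            (∀ j', dist (x i') (x j') ≤ 11 / 10 → ∀ k', k' ≠ j' →
                (55 : ℝ) / 57 ≤ dist (x j') (x k')) ∧
            (Finset.univ.filter fun j' => j' ≠ i' ∧ dist (x i') (x j') ≤ 1).card = 12 ∧
            (Finset.univ.filter fun j' => j' ≠ i' ∧ dist (x i') (x j') ≤ 11 / 10).card ≤ 12))).biUnion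
        (fun j => Finset.univ.filter fun i : Fin N => i ∉ (Finset.univ.filter fun i' : Fin _ => ¬ (
              (∀ j', dist (x i') (x j') ≤ 11 / 10 → ∀ k', k' ≠ j' →
                  (55 : ℝ) / 57 ≤ dist (x j') (x k')) ∧
              (Finset.univ.filter fun j' => j' ≠ i' ∧ dist (x i') (x j') ≤ 1).card = 12 ∧
              (Finset.univ.filter fun j' => j' ≠ i' ∧ dist (x i') (x j') ≤ 11 / 10).card ≤ 12)) ∧ dist (x i) (x j) ≤ D) := by
    intro i hi
    obtain ⟨j, hj, hjbad⟩ := (Finset.mem_filter.1 hi).2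
    by_cases hgi : i ∈ (Finset.univ.filter fun i' : Fin _ => ¬ (
          (∀ j', dist (x i') (x j') ≤ 11 / 10 → ∀ k', k' ≠ j' →
              (55 : ℝ) / 57 ≤ dist (x j') (x k')) ∧
          (Finset.univ.filter fun j' => j' ≠ i' ∧ dist (x i') (x j') ≤ 1).card = 12 ∧
          (Finset.univ.filter fun j' => j' ≠ i' ∧ dist (x i') (x j') ≤ 11 / 10).card ≤ 12))
    · exact Finset.mem_union_left _ hgi
    · apply Finset.mem_union_right
      rw [Finset.mem_biUnion]
      exact ⟨j, hjbad, Finset.mem_filter.2 ⟨Finset.mem_univ _, hgi, hj⟩⟩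
  have h1 : ((Finset.univ.filter fun i : Fin N => ∃ j : Fin N, dist (x i) (x j) ≤ D ∧ j ∈ (Finset.univ.filter fun i' : Fin _ => ¬ (
        (∀ j', dist (x i') (x j') ≤ 11 / 10 → ∀ k', k' ≠ j' →
            (55 : ℝ) / 57 ≤ dist (x j') (x k')) ∧
        (Finset.univ.filter fun j' => j' ≠ i' ∧ dist (x i') (x j') ≤ 1).card = 12 ∧
        (Finset.univ.filter fun j' => j' ≠ i' ∧ dist (x i') (x j') ≤ 11 / 10).card ≤ 12))).card : ℝ)
      ≤ ((Finset.univ.filter fun i' : Fin _ => ¬ (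
            (∀ j', dist (x i') (x j') ≤ 11 / 10 → ∀ k', k' ≠ j' →
                (55 : ℝ) / 57 ≤ dist (x j') (x k')) ∧
            (Finset.univ.filter fun j' => j' ≠ i' ∧ dist (x i') (x j') ≤ 1).card = 12 ∧
            (Finset.univ.filter fun j' => j' ≠ i' ∧ dist (x i') (x j') ≤ 11 / 10).card ≤ 12))).card + (((Finset.univ.filter fun i' : Fin _ => ¬ (
            (∀ j', dist (x i') (x j') ≤ 11 / 10 → ∀ k', k' ≠ j' →
                (55 : ℝ) / 57 ≤ dist (x j') (x k')) ∧
            (Finset.univ.filter fun j' => j' ≠ i' ∧ dist (x i') (x j') ≤ 1).card = 12 ∧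
            (Finset.univ.filter fun j' => j' ≠ i' ∧ dist (x i') (x j') ≤ 11 / 10).card ≤ 12))).biUnion (fun j => Finset.univ.filter fun i : Fin N =>
        i ∉ (Finset.univ.filter fun i' : Fin _ => ¬ (
              (∀ j', dist (x i') (x j') ≤ 11 / 10 → ∀ k', k' ≠ j' →
                  (55 : ℝ) / 57 ≤ dist (x j') (x k')) ∧
              (Finset.univ.filter fun j' => j' ≠ i' ∧ dist (x i') (x j') ≤ 1).card = 12 ∧
              (Finset.univ.filter fun j' => j' ≠ i' ∧ dist (x i') (x j') ≤ 11 / 10).card ≤ 12)) ∧ dist (x i) (x j) ≤ D)).card := by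
    exact_mod_cast (Finset.card_le_card hsub).trans (Finset.card_union_le _ _)
  have h2 : ((((Finset.univ.filter fun i' : Fin _ => ¬ (
        (∀ j', dist (x i') (x j') ≤ 11 / 10 → ∀ k', k' ≠ j' →
            (55 : ℝ) / 57 ≤ dist (x j') (x k')) ∧
        (Finset.univ.filter fun j' => j' ≠ i' ∧ dist (x i') (x j') ≤ 1).card = 12 ∧
        (Finset.univ.filter fun j' => j' ≠ i' ∧ dist (x i') (x j') ≤ 11 / 10).card ≤ 12))).biUnion (fun j => Finset.univ.filter fun i : Fin N =>
        i ∉ (Finset.univ.filter fun i' : Fin _ => ¬ (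
              (∀ j', dist (x i') (x j') ≤ 11 / 10 → ∀ k', k' ≠ j' →
                  (55 : ℝ) / 57 ≤ dist (x j') (x k')) ∧
              (Finset.univ.filter fun j' => j' ≠ i' ∧ dist (x i') (x j') ≤ 1).card = 12 ∧
              (Finset.univ.filter fun j' => j' ≠ i' ∧ dist (x i') (x j') ≤ 11 / 10).card ≤ 12)) ∧ dist (x i) (x j) ≤ D)).card : ℝ) ≤ ((Finset.univ.filter fun i' : Fin _ => ¬ (
              (∀ j', dist (x i') (x j') ≤ 11 / 10 → ∀ k', k' ≠ j' →
                  (55 : ℝ) / 57 ≤ dist (x j') (x k')) ∧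
              (Finset.univ.filter fun j' => j' ≠ i' ∧ dist (x i') (x j') ≤ 1).card = 12 ∧
              (Finset.univ.filter fun j' => j' ≠ i' ∧ dist (x i') (x j') ≤ 11 / 10).card ≤ 12))).card * (2 * D / (55 / 57) + 1) ^ 3 := by
    calc ((((Finset.univ.filter fun i' : Fin _ => ¬ (
          (∀ j', dist (x i') (x j') ≤ 11 / 10 → ∀ k', k' ≠ j' →
              (55 : ℝ) / 57 ≤ dist (x j') (x k')) ∧
          (Finset.univ.filter fun j' => j' ≠ i' ∧ dist (x i') (x j') ≤ 1).card = 12 ∧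
          (Finset.univ.filter fun j' => j' ≠ i' ∧ dist (x i') (x j') ≤ 11 / 10).card ≤ 12))).biUnion (fun j => Finset.univ.filter fun i : Fin N =>
          i ∉ (Finset.univ.filter fun i' : Fin _ => ¬ (
                (∀ j', dist (x i') (x j') ≤ 11 / 10 → ∀ k', k' ≠ j' →
                    (55 : ℝ) / 57 ≤ dist (x j') (x k')) ∧
                (Finset.univ.filter fun j' => j' ≠ i' ∧ dist (x i') (x j') ≤ 1).card = 12 ∧
                (Finset.univ.filter fun j' => j' ≠ i' ∧ dist (x i') (x j') ≤ 11 / 10).card ≤ 12)) ∧ dist (x i) (x j) ≤ D)).card : ℝ)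
        ≤ ∑ j ∈ (Finset.univ.filter fun i' : Fin _ => ¬ (
              (∀ j', dist (x i') (x j') ≤ 11 / 10 → ∀ k', k' ≠ j' →
                  (55 : ℝ) / 57 ≤ dist (x j') (x k')) ∧
              (Finset.univ.filter fun j' => j' ≠ i' ∧ dist (x i') (x j') ≤ 1).card = 12 ∧
              (Finset.univ.filter fun j' => j' ≠ i' ∧ dist (x i') (x j') ≤ 11 / 10).card ≤ 12)), ((Finset.univ.filter fun i : Fin N =>
            i ∉ (Finset.univ.filter fun i' : Fin _ => ¬ (
                  (∀ j', dist (x i') (x j') ≤ 11 / 10 → ∀ k', k' ≠ j' →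
                      (55 : ℝ) / 57 ≤ dist (x j') (x k')) ∧
                  (Finset.univ.filter fun j' => j' ≠ i' ∧ dist (x i') (x j') ≤ 1).card = 12 ∧
                  (Finset.univ.filter fun j' => j' ≠ i' ∧ dist (x i') (x j') ≤ 11 / 10).card ≤ 12)) ∧ dist (x i) (x j) ≤ D).card : ℝ) := by
          exact_mod_cast Finset.card_biUnion_le
      _ ≤ ∑ _j ∈ (Finset.univ.filter fun i' : Fin _ => ¬ (
            (∀ j', dist (x i') (x j') ≤ 11 / 10 → ∀ k', k' ≠ j' →
                (55 : ℝ) / 57 ≤ dist (x j') (x k')) ∧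
            (Finset.univ.filter fun j' => j' ≠ i' ∧ dist (x i') (x j') ≤ 1).card = 12 ∧
            (Finset.univ.filter fun j' => j' ≠ i' ∧ dist (x i') (x j') ≤ 11 / 10).card ≤ 12)), (2 * D / (55 / 57) + 1) ^ 3 :=
          Finset.sum_le_sum fun j _ => card_good_near_le x (x j) hD
      _ = ((Finset.univ.filter fun i' : Fin _ => ¬ (
            (∀ j', dist (x i') (x j') ≤ 11 / 10 → ∀ k', k' ≠ j' →
                (55 : ℝ) / 57 ≤ dist (x j') (x k')) ∧
            (Finset.univ.filter fun j' => j' ≠ i' ∧ dist (x i') (x j') ≤ 1).card = 12 ∧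
            (Finset.univ.filter fun j' => j' ≠ i' ∧ dist (x i') (x j') ≤ 11 / 10).card ≤ 12))).card * (2 * D / (55 / 57) + 1) ^ 3 := by simp
  have h0 : (0 : ℝ) ≤ ((Finset.univ.filter fun i' : Fin _ => ¬ (
        (∀ j', dist (x i') (x j') ≤ 11 / 10 → ∀ k', k' ≠ j' →
            (55 : ℝ) / 57 ≤ dist (x j') (x k')) ∧
        (Finset.univ.filter fun j' => j' ≠ i' ∧ dist (x i') (x j') ≤ 1).card = 12 ∧
        (Finset.univ.filter fun j' => j' ≠ i' ∧ dist (x i') (x j') ≤ 11 / 10).card ≤ 12))).card := by positivity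
  nlinarith

/-- **Bad sites spoil few balls** (`card_shallow_le` in closed form, the registered sub-goal of
this support file): for every configuration and every `D ≥ 0`, the sites having a bad site within
distance `D` number at most `#bad · (1 + (2D/(55/57) + 1)³)`. -/
theorem fiveFold_card_shallow_le :
    ∀ (N : ℕ) (x : Fin N → EuclideanSpace ℝ (Fin 3)) (D : ℝ), 0 ≤ D →
      ((Finset.univ.filter fun i : Fin N => ∃ j : Fin N, dist (x i) (x j) ≤ D ∧
          j ∈ (Finset.univ.filter fun i' : Fin N => ¬ (
            (∀ j', dist (x i') (x j') ≤ 11 / 10 → ∀ k', k' ≠ j' →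
                (55 : ℝ) / 57 ≤ dist (x j') (x k')) ∧
            (Finset.univ.filter fun j' => j' ≠ i' ∧ dist (x i') (x j') ≤ 1).card = 12 ∧
            (Finset.univ.filter fun j' => j' ≠ i' ∧ dist (x i') (x j') ≤ 11 / 10).card ≤ 12))).card : ℝ) ≤
        (Finset.univ.filter fun i' : Fin N => ¬ (
            (∀ j', dist (x i') (x j') ≤ 11 / 10 → ∀ k', k' ≠ j' →
                (55 : ℝ) / 57 ≤ dist (x j') (x k')) ∧
            (Finset.univ.filter fun j' => j' ≠ i' ∧ dist (x i') (x j') ≤ 1).card = 12 ∧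
            (Finset.univ.filter fun j' => j' ≠ i' ∧ dist (x i') (x j') ≤ 11 / 10).card ≤ 12)).card *
          (1 + (2 * D / (55 / 57) + 1) ^ 3) :=
  fun _ x _ hD => card_shallow_le x hD

/-- **Nets.** A finite family of points has a `D`-separated sub-family within distance `D` of
every member (a separated subset of maximal cardinality). -/
theorem exists_separated_net {ι : Type*} (J : Finset ι) (f : ι → EuclideanSpace ℝ (Fin 3)) {D : ℝ} (hD : 0 ≤ D) :
    ∃ M ⊆ J, (∀ m ∈ M, ∀ m' ∈ M, m ≠ m' → D < dist (f m) (f m')) ∧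
      ∀ j ∈ J, ∃ m ∈ M, dist (f j) (f m) ≤ D := by
  classical
  let P : Finset ι → Prop := fun M => ∀ m ∈ M, ∀ m' ∈ M, m ≠ m' → D < dist (f m) (f m')
  have hne : (J.powerset.filter P).Nonempty := ⟨∅, by simp [P]⟩
  obtain ⟨M, hM, hmax⟩ := Finset.exists_max_image (J.powerset.filter P) Finset.card hne
  have hMJ : M ⊆ J := Finset.mem_powerset.1 (Finset.mem_filter.1 hM).1
  have hPM : P M := (Finset.mem_filter.1 hM).2
  refine ⟨M, hMJ, hPM, ?_⟩
  intro j hj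
  by_contra hcon
  push Not at hcon
  have hjM : j ∉ M := by
    intro h
    have := hcon j h
    rw [dist_self] at this
    linarith
  have hP' : P (insert j M) := by
    intro m hm m' hm' hne
    have hm1 : m = j ∨ m ∈ M := Finset.mem_insert.1 hm
    have hm2 : m' = j ∨ m' ∈ M := Finset.mem_insert.1 hm'
    clear hm hm'
    rcases hm1 with rfl | hmM
    · rcases hm2 with rfl | hm'M
      · exact absurd rfl hne
      · exact hcon m' hm'M
    · rcases hm2 with rfl | hm'M
      · rw [dist_comm]; exact hcon m hmM
      · exact hPM m hmM m' hm'M hne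
  have hmem : insert j M ∈ J.powerset.filter P :=
    Finset.mem_filter.2 ⟨Finset.mem_powerset.2 (Finset.insert_subset hj hMJ), hP'⟩
  have := hmax _ hmem
  rw [Finset.card_insert_of_notMem hjM] at this
  omega

end Summit.AtomisticToContinuum.Crystallization.Theorems.SquareWellLayerCakeGapTwelveToBarlow

end
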